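import Summits.Ventures.HodgeRepro2.T5UnitaryGroupForm
import Summits.Ventures.HodgeRepro2.T5HeckeAdjointHermitian

/-!
# T5UnitaryHeckeAdjoint — the hyperspecial subgroup, the Cartan hypothesis as a named `Prop`, adjointness and
the Hecke eigencharacter for `U(J)` at an inert place (modulo the printed Cartan decomposition)

Blind cell pub-hodge-repro2, seat p8, Tier-5 kernel support (continuation of T5UnitaryGroupForm).

* `hyperspecialSubgroup R J` — `K_U := U(J) ∩ GL_n(R)` as a subgroup of `U(J) = formUnitaryGroup J`
  (the stabiliser of the self-dual lattice `R^n`; an `abbrev`, so every statement of T5UnitaryGroupForm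
  applies to it by unfolding).
* `IsCartanDecomposition R J σ ϖ : Prop` — the PRINTED Cartan decomposition
  `U(J) = ⋃_{m ∘ σ = −m} K_U · diag(ϖ^{m}) · K_U` as a named hypothesis. It is NOT proved here: for the
  record it is the Bruhat–Tits statement for the unramified unitary group and its hyperspecial `K`, consumed
  as an explicit hypothesis `h : IsCartanDecomposition R J σ ϖ` by every theorem below.
* `finite_orbit` — every `K_U g K_U / K_U` is finite, NO hypothesis (T5HeckeFiniteOrbitPullback).
* Modulo `h`: `heckeAlgebra_mul_comm` (commutativity), `ncard_orbit_inv_eq` (hU),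
  `apply_heckeSMul_doubleCosetOp_eq_inv` (`B(T_g v, w) = B(v, T_{g⁻¹} w)` — the printed `π(f)^* = π(f^*)` for a
  unitary `π`, from T5HeckeAdjointHermitian with `hK` and `hU` discharged), `apply_heckeSMul_eq_starOp`
  (`B(T v, w) = B(v, T^* w)` for every `T ∈ H(U(J), K_U)`), `finrank_invariants_eq_one` (the spherical line)
  and the eigencharacter `heckeCharacterAlgHom : H(U(J), K_U) →ₐ[k] k` of an irreducible `K_U`-finite
  representation (T5HeckeCommutativeMultiplicityOne instantiated) — the unitary-group analogue of
  T5SphericalMultiplicityOneGLn / T5HeckeAdjointGLn, with the Cartan decomposition as the single residual.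

Nothing is asserted about a specific unitary group; the Satake isomorphism stays prose.
-/

namespace Summit.Ventures.HodgeRepro2.T5UnitaryHeckeAdjoint

open Summit.Ventures.HodgeRepro2 Matrix

section Defs

variable (R : Type*) [CommRing R] {E : Type*} [Field E] [StarRing E] [Algebra R E] {ι : Type*}
  [Fintype ι] [DecidableEq ι]

/-- The hyperspecial subgroup `K_U = U(J) ∩ GL_n(R)` of `U(J)`, as a subgroup of `formUnitaryGroup J`. -/
abbrev hyperspecialSubgroup (J : Matrix ι ι E) : Subgroup (T5UnitaryGroupForm.formUnitaryGroup J) :=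
  (Matrix.GeneralLinearGroup.map (algebraMap R E)).range.subgroupOf (T5UnitaryGroupForm.formUnitaryGroup J)

/-- Membership in `K_U`: the matrix is integral (in the image of `GL_n(R)`). -/
theorem mem_hyperspecialSubgroup_iff {J : Matrix ι ι E} (g : T5UnitaryGroupForm.formUnitaryGroup J) :
    g ∈ hyperspecialSubgroup R J ↔
      (g : GL ι E) ∈ (Matrix.GeneralLinearGroup.map (algebraMap R E)).range :=
  Subgroup.mem_subgroupOf

/-- THE PRINTED CARTAN DECOMPOSITION AS A NAMED HYPOTHESIS: every `g ∈ U(J)` is `k₁ · diag(ϖ^{m}) · k₂` with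
`k₁, k₂ ∈ K_U` and `m ∘ σ = −m` (for `σ = Fin.rev`: `diag(ϖ^{m_1}, …, ϖ^{m_r}, 1, ϖ^{-m_r}, …, ϖ^{-m_1})`).
NOT proved in this tree — it is the Bruhat–Tits statement for the unramified unitary group with respect to a
hyperspecial maximal compact subgroup; every theorem below takes it as an explicit hypothesis. -/
def IsCartanDecomposition (J : Matrix ι ι E) (σ : Equiv.Perm ι) (ϖ : Eˣ) : Prop :=
  ∀ g : T5UnitaryGroupForm.formUnitaryGroup J,
    ∃ k₁ ∈ hyperspecialSubgroup R J, ∃ k₂ ∈ hyperspecialSubgroup R J, ∃ m : ι → ℤ,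
      (∀ i, m (σ i) = - m i) ∧
        (g : GL ι E) = k₁ * T5CartanUniformiser.diagonalUnit (fun i => ϖ ^ m i) * k₂

end Defs

section Main

variable {R : Type*} [CommRing R] {E : Type*} [Field E] [StarRing E] [Algebra R E] {ι : Type*}
  [Fintype ι] [DecidableEq ι] {J : Matrix ι ι E} {σ : Equiv.Perm ι} {ϖ : Eˣ}

/-- `g⁻¹ ∈ K_U g K_U` for every `g ∈ U(J)`, modulo the Cartan decomposition. -/
theorem inv_mem_orbit (hJ : ∀ i j, J (σ i) (σ j) = J i j) (h : IsCartanDecomposition R J σ ϖ)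
    (g : T5UnitaryGroupForm.formUnitaryGroup J) :
    (↑g⁻¹ : T5UnitaryGroupForm.formUnitaryGroup J ⧸ hyperspecialSubgroup R J) ∈
      MulAction.orbit (hyperspecialSubgroup R J) (↑g) :=
  T5UnitaryGroupForm.inv_mem_orbit_of_cartan J σ hJ ϖ h g

/-- The counting form of unimodularity for `U(J)` modulo the Cartan decomposition:
`#(K_U g⁻¹ K_U / K_U) = #(K_U g K_U / K_U)`. -/
theorem ncard_orbit_inv_eq (hJ : ∀ i j, J (σ i) (σ j) = J i j) (h : IsCartanDecomposition R J σ ϖ)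
    (g : T5UnitaryGroupForm.formUnitaryGroup J) :
    (MulAction.orbit (hyperspecialSubgroup R J)
        (↑g⁻¹ : T5UnitaryGroupForm.formUnitaryGroup J ⧸ hyperspecialSubgroup R J)).ncard =
      (MulAction.orbit (hyperspecialSubgroup R J)
        (↑g : T5UnitaryGroupForm.formUnitaryGroup J ⧸ hyperspecialSubgroup R J)).ncard :=
  T5UnitaryGroupForm.ncard_orbit_inv_eq_of_cartan J σ hJ ϖ h g

variable [IsDomain R] [IsFractionRing R E] [IsDiscreteValuationRing R]
  [Finite (IsLocalRing.ResidueField R)]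

/-- Every `K_U g K_U / K_U` is finite — no hypothesis (T5HeckeFiniteOrbitPullback). -/
theorem finite_orbit (J : Matrix ι ι E) (g : T5UnitaryGroupForm.formUnitaryGroup J) :
    Finite (MulAction.orbit (hyperspecialSubgroup R J)
      (↑g : T5UnitaryGroupForm.formUnitaryGroup J ⧸ hyperspecialSubgroup R J)) :=
  T5HeckeFiniteOrbitPullback.finite_orbit_subgroupOf_GL (T5UnitaryGroupForm.formUnitaryGroup J) g

/-- `H(U(J), K_U)` is commutative modulo the Cartan decomposition. -/
theorem heckeAlgebra_mul_comm (hJ : ∀ i j, J (σ i) (σ j) = J i j) (h : IsCartanDecomposition R J σ ϖ)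
    (k : Type*) [Field k] (T S : T5HeckePermutationModule.heckeAlgebra k (hyperspecialSubgroup R J)) :
    T * S = S * T :=
  T5UnitaryGroupForm.heckeAlgebra_mul_comm_of_cartan J σ hJ ϖ h k T S

/-- `B(T_g v, w) = B(v, T_{g⁻¹} w)` on `ρ^{K_U}` for every `U(J)`-invariant hermitian form `B` — the printed
`π(f)^* = π(f^*)` for a unitary `π` at an inert place, modulo the Cartan decomposition
(T5HeckeAdjointHermitian with `hK := finite_orbit`, `hU := ncard_orbit_inv_eq`). -/
theorem apply_heckeSMul_doubleCosetOp_eq_inv (hJ : ∀ i j, J (σ i) (σ j) = J i j)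
    (h : IsCartanDecomposition R J σ ϖ) {k : Type*} [Field k] [StarRing k] {V : Type*} [AddCommGroup V]
    [Module k V] {ρ : Representation k (T5UnitaryGroupForm.formUnitaryGroup J) V}
    {B : V →ₗ⋆[k] V →ₗ[k] k} (hB : T5HeckeAdjointHermitian.IsInvariantSesq ρ B)
    (hH : T5HeckeAdjointHermitian.IsHermitian B) (g : T5UnitaryGroupForm.formUnitaryGroup J)
    (v w : LevelPositivity.invariants ρ (hyperspecialSubgroup R J)) :
    B (T5HeckePermutationModule.heckeSMul ρ
        (T5HeckeDoubleCoset.doubleCosetOp k (hyperspecialSubgroup R J) g) v) w =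
      B v (T5HeckePermutationModule.heckeSMul ρ
        (T5HeckeDoubleCoset.doubleCosetOp k (hyperspecialSubgroup R J) g⁻¹) w) :=
  T5HeckeAdjointHermitian.apply_heckeSMul_doubleCosetOp_eq_apply_heckeSMul_doubleCosetOp_inv
    (finite_orbit J) hB hH g (ncard_orbit_inv_eq hJ h g) v w

/-- `B(T v, w) = B(v, T^* w)` for every `T ∈ H(U(J), K_U)`, `T^*` the `∗`-involution of T5HeckeStar, modulo the
Cartan decomposition. -/
theorem apply_heckeSMul_eq_starOp (hJ : ∀ i j, J (σ i) (σ j) = J i j)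
    (h : IsCartanDecomposition R J σ ϖ) {k : Type*} [Field k] [StarRing k] {V : Type*} [AddCommGroup V]
    [Module k V] {ρ : Representation k (T5UnitaryGroupForm.formUnitaryGroup J) V}
    {B : V →ₗ⋆[k] V →ₗ[k] k} (hB : T5HeckeAdjointHermitian.IsInvariantSesq ρ B)
    (hH : T5HeckeAdjointHermitian.IsHermitian B)
    (T : T5HeckePermutationModule.heckeAlgebra k (hyperspecialSubgroup R J))
    (v w : LevelPositivity.invariants ρ (hyperspecialSubgroup R J)) :
    B (T5HeckePermutationModule.heckeSMul ρ T v) w =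
      B v (T5HeckePermutationModule.heckeSMul ρ (T5HeckeStar.starOp (finite_orbit J) T) w) :=
  T5HeckeAdjointHermitian.apply_heckeSMul_eq_apply_heckeSMul_starOp (finite_orbit J)
    (ncard_orbit_inv_eq hJ h) hB hH T v w

/-- The spherical line of an irreducible `K_U`-finite representation is one-dimensional, modulo the Cartan
decomposition (`k` algebraically closed of characteristic `0`, `ρ^{K_U} ≠ 0` finite-dimensional). -/
theorem finrank_invariants_eq_one (hJ : ∀ i j, J (σ i) (σ j) = J i j)
    (h : IsCartanDecomposition R J σ ϖ) {k : Type*} [Field k] [CharZero k] [IsAlgClosed k] {V : Type*}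
    [AddCommGroup V] [Module k V] (ρ : Representation k (T5UnitaryGroupForm.formUnitaryGroup J) V)
    [ρ.IsIrreducible] (hKF : T5LevelIdempotent.KFinite ρ (hyperspecialSubgroup R J))
    [FiniteDimensional k (LevelPositivity.invariants ρ (hyperspecialSubgroup R J))]
    (hne : LevelPositivity.invariants ρ (hyperspecialSubgroup R J) ≠ ⊥) :
    Module.finrank k (LevelPositivity.invariants ρ (hyperspecialSubgroup R J)) = 1 :=
  T5UnitaryGroupForm.finrank_invariants_eq_one_of_cartan J σ hJ ϖ h ρ hKF hne

/-- THE HECKE EIGENCHARACTER of an irreducible `K_U`-finite representation of `U(J)` with `ρ^{K_U} ≠ 0`: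
`H(U(J), K_U) →ₐ[k] k`, `T ↦` the scalar by which `T` acts on the spherical line — modulo the Cartan
decomposition (T5HeckeCommutativeMultiplicityOne instantiated; the identification of this character with a
Satake parameter stays prose). -/
noncomputable def heckeCharacterAlgHom (hJ : ∀ i j, J (σ i) (σ j) = J i j)
    (h : IsCartanDecomposition R J σ ϖ) {k : Type*} [Field k] [CharZero k] [IsAlgClosed k] {V : Type*}
    [AddCommGroup V] [Module k V] (ρ : Representation k (T5UnitaryGroupForm.formUnitaryGroup J) V)
    [ρ.IsIrreducible] (hKF : T5LevelIdempotent.KFinite ρ (hyperspecialSubgroup R J))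
    [FiniteDimensional k (LevelPositivity.invariants ρ (hyperspecialSubgroup R J))]
    (hne : LevelPositivity.invariants ρ (hyperspecialSubgroup R J) ≠ ⊥) :
    T5HeckePermutationModule.heckeAlgebra k (hyperspecialSubgroup R J) →ₐ[k] k :=
  T5HeckeCommutativeMultiplicityOne.heckeCharacterAlgHom ρ hKF (finite_orbit J) hne
    (heckeAlgebra_mul_comm hJ h k)

end Main

end Summit.Ventures.HodgeRepro2.T5UnitaryHeckeAdjoint
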